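import Literature.NumberTheory.DiophantineGeometry.AbcShapeCount
import Literature.NumberTheory.DiophantineGeometry.AbcShapeReduction
import HarnessLib

/-!
# Sub-boxes with frozen coordinates, and the split of a shape value along a set of coordinates

Bookkeeping for the bounds of [BernertEtAl2024, Props. 3.1 and 4.1 (arXiv v2)], which single out a
*set* `S` of the shape variables: the sub-box `subBox S X` of `box X` with the coordinates in `S`
frozen at the corner (`#subBox S X = ∏_{i∉S} Xᵢ`), freezing / merging maps with
`mergeOn S (freezeOn S X y) (freezeOn Sᶜ X y) = y`, the factorisation
`∏ᵢ yᵢ^{i+1} = offVal_S · W_S` of the shape value (`shapeVal_mergeOn`), the `e`-th root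
`u_S = ∏_{i∈S} sᵢ^{(i+1)/e}` of `W_S` when `e ∣ i+1` on `S` (`onVal_eq_uVal_pow`), and the
divisor-tuple count `card_subBox_filter_dvd_le`. No theorem of the source is proved here.

## References

* [BernertEtAl2024] C. Bernert, T. Browning, J. D. Lichtman, J. Teräväinen, *Bounds on the
  exceptional set in the abc conjecture*, arXiv:2410.12234v2, Propositions 3.1, 4.1.
-/

noncomputable section

open Finset

namespace Literature.NumberTheory.DiophantineGeometry

namespace AbcShapes

/-! ### Sub-boxes with frozen coordinates -/

/-- The sub-box of `box X` whose coordinates in `S` are frozen at the corner `Xᵢ`. [folklore] -/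
def subBox {d : ℕ} (S : Finset (Fin d)) (X : Fin d → ℕ) : Finset (Fin d → ℕ) :=
  Fintype.piFinset fun i => if i ∈ S then {X i} else Ico (X i) (2 * X i)

/-- Freeze the coordinates in `S` at the corner. [folklore] -/
def freezeOn {d : ℕ} (S : Finset (Fin d)) (X y : Fin d → ℕ) : Fin d → ℕ :=
  fun i => if i ∈ S then X i else y i

/-- Take the coordinates in `S` from `s` and the others from `r`. [folklore] -/
def mergeOn {d : ℕ} (S : Finset (Fin d)) (r s : Fin d → ℕ) : Fin d → ℕ :=
  fun i => if i ∈ S then s i else r i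

/-- The part of the shape value carried by the coordinates in `S`: `W_S(s) = ∏_{i∈S} sᵢ^{i+1}`.
[cite: BernertEtAl2024, Proposition 3.1] -/
def onVal {d : ℕ} (S : Finset (Fin d)) (s : Fin d → ℕ) : ℕ :=
  ∏ i ∈ S, s i ^ ((i : ℕ) + 1)

/-- The part of the shape value carried by the coordinates off `S`. [folklore] -/
def offVal {d : ℕ} (S : Finset (Fin d)) (r : Fin d → ℕ) : ℕ :=
  ∏ i ∈ Sᶜ, r i ^ ((i : ℕ) + 1)

/-- `u_S(s) = ∏_{i∈S} sᵢ^{(i+1)/e}`, so that `W_S(s) = u_S(s)^e` when `e ∣ i + 1` on `S`.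
[cite: BernertEtAl2024, Proposition 3.1] -/
def uVal {d : ℕ} (S : Finset (Fin d)) (e : ℕ) (s : Fin d → ℕ) : ℕ :=
  ∏ i ∈ S, s i ^ (((i : ℕ) + 1) / e)

/-- Membership in a sub-box. [folklore] -/
theorem mem_subBox {d : ℕ} {S : Finset (Fin d)} {X r : Fin d → ℕ} :
    r ∈ subBox S X ↔ ∀ i, (i ∈ S → r i = X i) ∧ (i ∉ S → X i ≤ r i ∧ r i < 2 * X i) := by
  simp only [subBox, Fintype.mem_piFinset]
  refine forall_congr' fun i => ?_
  by_cases hi : i ∈ S <;> simp [hi, mem_Ico]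

/-- `#subBox S X = ∏_{i ∉ S} Xᵢ`. [folklore] -/
theorem card_subBox {d : ℕ} (S : Finset (Fin d)) (X : Fin d → ℕ) :
    (subBox S X).card = ∏ i ∈ Sᶜ, X i := by
  classical
  rw [subBox, Fintype.card_piFinset]
  have : ∀ i : Fin d, (if i ∈ S then ({X i} : Finset ℕ) else Ico (X i) (2 * X i)).card =
      if i ∈ S then 1 else X i := by
    intro i
    split_ifs
    · exact card_singleton _
    · rw [Nat.card_Ico]; omega
  simp_rw [this]
  rw [prod_ite, prod_const_one, one_mul]
  exact prod_congr (by ext i; simp [mem_compl]) fun _ _ => rfl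

/-- `#subBox S X · ∏_{i∈S} Xᵢ = #box X`. [folklore] -/
theorem card_subBox_mul {d : ℕ} (S : Finset (Fin d)) (X : Fin d → ℕ) :
    (subBox S X).card * ∏ i ∈ S, X i = (dyadicBox X).card := by
  classical
  rw [card_subBox, card_dyadicBox, mul_comm, ← Finset.prod_mul_prod_compl S]

/-- Points of a sub-box are points of the box. [folklore] -/
theorem subBox_subset {d : ℕ} {S : Finset (Fin d)} {X : Fin d → ℕ} (hX : ∀ i, 0 < X i) :
    subBox S X ⊆ dyadicBox X := by
  intro r hr
  rw [mem_subBox] at hr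
  rw [mem_dyadicBox]
  intro i
  by_cases hi : i ∈ S
  · rw [(hr i).1 hi]; have := hX i; omega
  · exact (hr i).2 hi

/-- Freezing a box point on `S` gives a point of the sub-box frozen on `S`. [folklore] -/
theorem freezeOn_mem_subBox {d : ℕ} (S : Finset (Fin d)) {X y : Fin d → ℕ} (hy : y ∈ dyadicBox X) :
    freezeOn S X y ∈ subBox S X := by
  rw [mem_subBox]; intro i
  constructor
  · intro hi; simp [freezeOn, hi]
  · intro hi; simp only [freezeOn, hi, if_false]; exact (mem_dyadicBox.mp hy) i

/-- Merging the two frozen halves recovers the point. [folklore] -/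
theorem mergeOn_freezeOn {d : ℕ} (S : Finset (Fin d)) (X y : Fin d → ℕ) :
    mergeOn S (freezeOn S X y) (freezeOn Sᶜ X y) = y := by
  funext i
  by_cases hi : i ∈ S
  · simp [mergeOn, freezeOn, hi]
  · have : i ∈ Sᶜ := mem_compl.mpr hi
    simp [mergeOn, freezeOn, hi]

/-- `V(merge r s) = offVal_S(r) · W_S(s)`. [folklore] -/
theorem shapeVal_mergeOn {d : ℕ} (S : Finset (Fin d)) (r s : Fin d → ℕ) :
    shapeVal (mergeOn S r s) = offVal S r * onVal S s := by
  classical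
  rw [shapeVal, ← Finset.prod_mul_prod_compl S, mul_comm, onVal, offVal]
  congr 1
  · exact prod_congr rfl fun i hi => by rw [mem_compl] at hi; simp [mergeOn, hi]
  · exact prod_congr rfl fun i hi => by simp [mergeOn, hi]

/-- `W_S(s) = u_S(s)^e` when `e ∣ i + 1` for all `i ∈ S`. [cite: BernertEtAl2024, Proposition 3.1] -/
theorem onVal_eq_uVal_pow {d : ℕ} {S : Finset (Fin d)} {e : ℕ} (hS : ∀ i ∈ S, e ∣ (i : ℕ) + 1)
    (s : Fin d → ℕ) : onVal S s = uVal S e s ^ e := by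
  rw [onVal, uVal, ← prod_pow]
  exact prod_congr rfl fun i hi => by rw [← pow_mul, Nat.div_mul_cancel (hS i hi)]

/-- Each coordinate in `S` divides `u_S(s)` (as `e ∣ i+1` gives `(i+1)/e ≥ 1`), and each
coordinate in `S` divides `W_S(s)`; each coordinate off `S` divides `offVal_S(r)`. [folklore] -/
theorem dvd_uVal {d : ℕ} {S : Finset (Fin d)} {e : ℕ} (he : 0 < e) (hS : ∀ i ∈ S, e ∣ (i : ℕ) + 1)
    (s : Fin d → ℕ) {i : Fin d} (hi : i ∈ S) : s i ∣ uVal S e s := by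
  have h1 : 1 ≤ ((i : ℕ) + 1) / e := (Nat.one_le_div_iff he).mpr (Nat.le_of_dvd (Nat.succ_pos _) (hS i hi))
  exact (dvd_pow_self (s i) (by omega)).trans (dvd_prod_of_mem (fun i => s i ^ (((i : ℕ) + 1) / e)) hi)

/-- Each coordinate in `S` divides `W_S(s)`. [folklore] -/
theorem dvd_onVal {d : ℕ} (S : Finset (Fin d)) (s : Fin d → ℕ) {i : Fin d} (hi : i ∈ S) :
    s i ∣ onVal S s :=
  (dvd_pow_self (s i) (Nat.succ_ne_zero _)).trans (dvd_prod_of_mem (fun i => s i ^ ((i : ℕ) + 1)) hi)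

/-- Each coordinate off `S` divides `offVal_S(r)`. [folklore] -/
theorem dvd_offVal {d : ℕ} (S : Finset (Fin d)) (r : Fin d → ℕ) {i : Fin d} (hi : i ∉ S) :
    r i ∣ offVal S r :=
  (dvd_pow_self (r i) (Nat.succ_ne_zero _)).trans
    (dvd_prod_of_mem (fun i => r i ^ ((i : ℕ) + 1)) (mem_compl.mpr hi))

/-- In a sub-box frozen on `T`, the tuples all of whose free coordinates divide `m ≠ 0` number at
most `τ(m)^d` (`1 ≤ τ(m)`). [folklore] -/
theorem card_subBox_filter_dvd_le {d : ℕ} (T : Finset (Fin d)) (X : Fin d → ℕ) {m : ℕ} (hm : m ≠ 0)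
    (P : (Fin d → ℕ) → Prop) [DecidablePred P] (hP : ∀ r ∈ subBox T X, P r → ∀ i, i ∉ T → r i ∣ m) :
    ((subBox T X).filter P).card ≤ m.divisors.card ^ d := by
  classical
  have hτ : 1 ≤ m.divisors.card := Finset.card_pos.mpr ⟨1, Nat.one_mem_divisors.mpr hm⟩
  calc ((subBox T X).filter P).card
      ≤ (Fintype.piFinset fun i => if i ∈ T then ({X i} : Finset ℕ) else m.divisors).card := by
        refine card_le_card fun r hr => ?_
        obtain ⟨hr1, hr2⟩ := mem_filter.mp hr
        refine Fintype.mem_piFinset.mpr fun i => ?_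
        by_cases hi : i ∈ T
        · rw [if_pos hi, mem_singleton]; exact ((mem_subBox.mp hr1) i).1 hi
        · rw [if_neg hi]; exact Nat.mem_divisors.mpr ⟨hP r hr1 hr2 i hi, hm⟩
    _ = ∏ i : Fin d, (if i ∈ T then ({X i} : Finset ℕ) else m.divisors).card := Fintype.card_piFinset _
    _ ≤ ∏ _i : Fin d, m.divisors.card := by
        refine prod_le_prod (fun i _ => Nat.zero_le _) fun i _ => ?_
        split_ifs
        · rw [card_singleton]; exact hτ
        · exact le_rfl
    _ = m.divisors.card ^ d := by rw [prod_const, card_univ, Fintype.card_fin]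

end AbcShapes

end Literature.NumberTheory.DiophantineGeometry
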